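import Mathlib
import Summits.ResolutionOfSingularities.ResolutionOfSingularities.Theorems.RadicialJungCleanModelsCentreBlowup
import HarnessLib

/-!
# Route `RadicialJung`, crux `CleanModels` (stmt-ResolutionOfSingularities-15917), line `Sketch` rev 35, stub 6 `stub_cleanProp44` (X44c):
# CLEAN-PERMISSIBILITY OF NEAR LINES, II — the NORMAL FORM of the transform of an adapted monomial at a point of the blowing up

Seat decomp-res-hand-2 g18 (structural hand).  The computation buried inside ✓ `looseCleanForm_centreChart_of_monomial`
(`…CentreBlowupChart.lean`, L7a) — «in the `cᵢ`-chart `ψ(u · ∏ c_k^{a_k} · ∏ w_m^{b_m}) = U · ψ(cᵢ)^A · ∏_{charged} u_k^{a_k} · ∏ ψ(w_m)^{b_m}` with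
`A = Σ a_k`, `U = ψ(u) · ∏_{uncharged} u_k^{a_k}` a unit and `(ψ cᵢ, (u_k)_{charged}, ψ w)` part of a regular system of parameters» — EXPORTED as a
statement, at the three levels of the dossier, so that the births / near-line analysis of the Phase II residual (R1ᵐⁱⁿ) (hand-2 g17 census §2 (a) (ii);
companion file `…CleanProp44NearLineLocal.lean`) can be run at the points of an actual blowing up:

* `exists_transform_normalForm_centreChart` — ABSTRACT CHART DATA `(A, ψ, u_k, ε, 𝔓, L = A_𝔓)` of the blowing up of a regular local ring `R` along
  the part `c` of a regular system of parameters `(c, w)` (format of `BlowupChartRsop.lean`): an injective enumeration `jJ` of EXACTLY the charged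
  indices (`k ≠ i`, `u_k ∈ 𝔓`), the regular-system-part property of `(ψ cᵢ, u_{jJ}, ψ w)` (✓ `isRsopPart_chartFamily`), the unit
  `U = ψ(u) ∏_k u_k^{a'_k}` (`a'` = `a` zeroed on the charged indices) and the displayed factorisation in `L`.
* `exists_transform_normalForm_reesChart` — the same for the Rees chart `(R[It])_{(cᵢ t)}` presented by a ring map `χ` (format of
  ✓ `IsBlowup.exists_reesChart_stalk`), with the family spelled out as elements of `L`.
* `exists_transform_normalForm_of_isBlowup` — SCHEME LEVEL: for a blowing up `τ : X' → X` along `J` (`IsBlowup`), a point `x'`, a regular system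
  of parameters `(c, w)` of `𝒪_{X,τ x'}` with `(c) = J_{τ x'}`, a unit `u` and exponents `a, b`: a chart index `i`, the fractions `uf_k ∈ 𝒪_{X',x'}`
  (`τ^♯ c_k = τ^♯ cᵢ · uf_k`, `uf_i = 1`), the charged enumeration, `IsRsopPart (τ^♯ cᵢ, uf_{charged}, τ^♯ w)`, the unit and the factorisation of
  `τ^♯(u ∏ c^a ∏ w^b)`.

Honest framing: OURS, bookkeeping (no new mathematics beyond L7a); a TOOL.  Nothing here proves X44c, any case of `CleanModels`, or resolution of
singularities in characteristic `p`.  Setting only: [cite: DeJong1996, 2.4] [cite: StacksProject, Tag 0804] [cite: Piltant2013, §2 Axiom 2 (ii)].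
-/

noncomputable section

set_option linter.dupNamespace false -- mandated namespace of this single-conjunct summit

open IsLocalRing MvPolynomial CategoryTheory AlgebraicGeometry
open Literature.AlgebraicGeometry.Resolution

namespace Summit.ResolutionOfSingularities.ResolutionOfSingularities.Theorems.RadicialJung.CleanModels

universe u

/-! ## §1 Abstract chart data -/

section AbstractChart

variable {R : Type u} [CommRing R] [IsRegularLocalRing R] {n : ℕ} (c : Fin n → R) (i : Fin n) {l : ℕ} (w : Fin l → R)
  (hz : Ideal.span (Set.range (Fin.append c w)) = maximalIdeal R) (hd : (maximalIdeal R).spanFinrank = n + l)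
  {A : Type u} [CommRing A] (ψ : R →+* A) (uA : Fin n → A)
  (hrel : ∀ k, ψ (c k) = ψ (c i) * uA k) (hnzd : ψ (c i) ∈ nonZeroDivisors A)
  (ε : MvPolynomial {k : Fin n // k ≠ i} (R ⧸ Ideal.span (Set.range c)) ≃+* A ⧸ Ideal.span {ψ (c i)})
  (hεC : ∀ r : R, ε (C (Ideal.Quotient.mk (Ideal.span (Set.range c)) r)) = Ideal.Quotient.mk _ (ψ r))
  (hεX : ∀ k : {k : Fin n // k ≠ i}, ε (X k) = Ideal.Quotient.mk _ (uA k.1))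
  (𝔓 : Ideal A) [𝔓.IsPrime] (h𝔓 : 𝔓.comap ψ = maximalIdeal R)
  (L : Type u) [CommRing L] [IsLocalRing L] [Algebra A L] [IsLocalization.AtPrime L 𝔓]

include hz hd hrel hnzd hεC hεX h𝔓 in
/-- **NORMAL FORM OF THE TRANSFORM OF AN ADAPTED MONOMIAL, abstract chart.**  In the `cᵢ`-chart of the blowing up of `R` along `(c)`, at the
point `L = A_𝔓`: there is an injective enumeration `jJ` of exactly the CHARGED indices `k ≠ i` (`u_k ∈ 𝔓`) such that `(ψ cᵢ, (u_{jJ q})_q, (ψ w_m)_m)`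
is part of a regular system of parameters of `L`, the element `U = ψ(u) · ∏_k u_k^{a'_k}` (`a'_k = 0` if `u_k ∈ 𝔓`, else `a_k`) lies outside `𝔓`
(so is a unit of `L`), and
`ψ(u · ∏_k c_k^{a_k} · ∏_m w_m^{b_m}) = U · ψ(cᵢ)^{Σ_k a_k} · ∏_q u_{jJ q}^{a_{jJ q}} · ∏_m ψ(w_m)^{b_m}` in `L`.
[cite: DeJong1996, 2.4] [cite: Piltant2013, §2 Axiom 2 (ii)] -/
theorem exists_transform_normalForm_centreChart [IsNoetherianRing A] (a : Fin n → ℕ) (b : Fin l → ℕ) {u : R} (hu : IsUnit u) :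
    ∃ (m : ℕ) (jJ : Fin m → {k : Fin n // k ≠ i}), Function.Injective jJ ∧ (∀ q, uA (jJ q).1 ∈ 𝔓) ∧
      (∀ k : Fin n, k ≠ i → uA k ∈ 𝔓 → ∃ q, (jJ q).1 = k) ∧
      IsRsopPart (chartFamily c i w L ψ uA jJ) ∧
      ∃ U : A, U ∉ 𝔓 ∧ IsUnit (algebraMap A L U) ∧ (U * ∏ q, uA (jJ q).1 ^ a (jJ q).1 = ψ u * ∏ k, uA k ^ a k) ∧
      algebraMap A L (ψ (u * (∏ k, c k ^ a k) * ∏ m', w m' ^ b m')) =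
        algebraMap A L U * algebraMap A L (ψ (c i)) ^ (∑ k, a k) *
          (∏ q, algebraMap A L (uA (jJ q).1) ^ a (jJ q).1) * ∏ m', algebraMap A L (ψ (w m')) ^ b m' := by
  classical
  have hP : 𝔓.IsPrime := ‹_›
  have hui : uA i = 1 := centreChartFrac_self c i ψ uA hrel hnzd
  -- uncharged exponents `a'` and the unit part `bU`
  set a' : Fin n → ℕ := fun k => if uA k ∈ 𝔓 then 0 else a k with ha'
  set bU : A := ψ u * ∏ k, uA k ^ a' k with hbU
  have hbU𝔓 : bU ∉ 𝔓 := by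
    intro h
    rcases hP.mem_or_mem h with h1 | h1
    · exact hP.ne_top' (Ideal.eq_top_of_isUnit_mem 𝔓 h1 (hu.map ψ))
    · rw [Ideal.IsPrime.prod_mem_iff] at h1
      obtain ⟨k, -, hk⟩ := h1
      by_cases hk𝔓 : uA k ∈ 𝔓
      · rw [ha'] at hk; simp only [hk𝔓, if_true, pow_zero] at hk
        exact hP.ne_top' ((Ideal.eq_top_iff_one 𝔓).mpr hk)
      · rw [ha'] at hk; simp only [hk𝔓, if_false] at hk
        exact hk𝔓 (hP.mem_of_pow_mem _ hk)
  have hbUunit : IsUnit (algebraMap A L bU) := IsLocalization.map_units L (⟨bU, hbU𝔓⟩ : 𝔓.primeCompl)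
  -- the charged set and its enumeration
  set N : Finset (Fin n) := Finset.univ.filter (fun k => uA k ∈ 𝔓) with hN
  let emb : Fin N.card ↪o Fin n := N.orderEmbOfFin rfl
  have hembN : ∀ k, uA (emb k) ∈ 𝔓 := fun k => (Finset.mem_filter.mp (N.orderEmbOfFin_mem rfl k)).2
  have hne : ∀ k, emb k ≠ i := by
    intro k h
    have h1 := hembN k
    rw [h, hui] at h1
    exact hP.ne_top' ((Ideal.eq_top_iff_one 𝔓).mpr h1)
  obtain ⟨jJ, hjJv⟩ : ∃ jJ : Fin N.card → {k : Fin n // k ≠ i}, ∀ k, (jJ k).1 = emb k :=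
    ⟨fun k => ⟨emb k, hne k⟩, fun k => rfl⟩
  have hjJ : Function.Injective jJ := fun k k' h => emb.injective (by rw [← hjJv k, ← hjJv k', h])
  have hrsop : IsRsopPart (chartFamily c i w L ψ uA jJ) :=
    isRsopPart_chartFamily c i w hz hd L ψ uA hnzd ε hεC hεX 𝔓 h𝔓 jJ hjJ (fun k => by rw [hjJv]; exact hembN k)
  have hcomplete : ∀ k : Fin n, k ≠ i → uA k ∈ 𝔓 → ∃ q, (jJ q).1 = k := by
    intro k _ hk
    have hkN : k ∈ Set.range emb := by
      rw [N.range_orderEmbOfFin rfl]; exact Finset.mem_filter.mpr ⟨Finset.mem_univ _, hk⟩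
    obtain ⟨q, hq⟩ := hkN
    exact ⟨q, by rw [hjJv, hq]⟩
  -- (i) the product splits: `∏ u_k^{a_k} = ∏ u_k^{a'_k} · ∏_{k ∈ N} u_k^{a_k}`
  have hsplitA : ∏ k, uA k ^ a k = (∏ k, uA k ^ a' k) * ∏ k ∈ N, uA k ^ a k := by
    rw [hN, Finset.prod_filter, ← Finset.prod_mul_distrib]
    refine Finset.prod_congr rfl fun k _ => ?_
    by_cases hk : uA k ∈ 𝔓
    · simp [ha', hk]
    · simp [ha', hk]
  have hprodN : ∏ k ∈ N, uA k ^ a k = ∏ q : Fin N.card, uA (jJ q).1 ^ a (jJ q).1 := by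
    have hmap : (Finset.univ : Finset (Fin N.card)).map emb.toEmbedding = N := by
      apply Finset.coe_injective
      rw [Finset.coe_map, Finset.coe_univ, Set.image_univ]
      exact N.range_orderEmbOfFin rfl
    rw [← Finset.prod_congr hmap (fun _ _ => rfl), Finset.prod_map]
    exact Finset.prod_congr rfl fun q _ => by rw [hjJv]; rfl
  -- (ii) the identity in `A`
  have hψ : ψ (u * (∏ k, c k ^ a k) * ∏ m', w m' ^ b m') =
      ψ (c i) ^ (∑ k, a k) * (bU * ∏ k ∈ N, uA k ^ a k) * ∏ m', ψ (w m') ^ b m' := by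
    rw [map_mul, map_mul, map_prod, map_prod]
    have h1 : ∏ k, ψ (c k ^ a k) = ∏ k, (ψ (c i) ^ a k * uA k ^ a k) :=
      Finset.prod_congr rfl fun k _ => by rw [map_pow, hrel k, mul_pow]
    rw [h1, Finset.prod_mul_distrib, Finset.prod_pow_eq_pow_sum, hsplitA, hbU]
    simp only [map_pow]
    ring
  have hUeq : bU * ∏ q : Fin N.card, uA (jJ q).1 ^ a (jJ q).1 = ψ u * ∏ k, uA k ^ a k := by
    rw [hsplitA, hprodN, hbU, mul_assoc]
  refine ⟨N.card, jJ, hjJ, fun q => by rw [hjJv]; exact hembN q, hcomplete, hrsop, bU, hbU𝔓, hbUunit, hUeq, ?_⟩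
  rw [hψ, hprodN]
  simp only [map_mul, map_pow, map_prod]
  ring

end AbstractChart

/-! ## §2 The Rees chart presented by a ring map -/

section ReesChart

variable {R : Type u} [CommRing R] [IsRegularLocalRing R] {n : ℕ} (c : Fin n → R) (i : Fin n) {l : ℕ} (w : Fin l → R)
  (hz : Ideal.span (Set.range (Fin.append c w)) = maximalIdeal R) (hd : (maximalIdeal R).spanFinrank = n + l)
  (𝔴 : Ideal (chartRing c i)) [𝔴.IsPrime] (h𝔴 : 𝔴.comap (chartBase c i) = maximalIdeal R)
  (L : Type u) [CommRing L] [IsLocalRing L] (χ : chartRing c i →+* L)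
  (hloc : @IsLocalization.AtPrime _ _ L _ χ.toAlgebra 𝔴 _)

include hz hd h𝔴 hloc in
/-- **Normal form of the transform, Rees chart** (`exists_transform_normalForm_centreChart` for `A = (R[It])_{(cᵢ t)}`, `ψ = chartBase`,
`u_k = chartGen`, `L = A_𝔴` presented by `χ`; the family spelled out as elements of `L`). [cite: DeJong1996, 2.4] [cite: StacksProject, Tag 0804] -/
theorem exists_transform_normalForm_reesChart (a : Fin n → ℕ) (b : Fin l → ℕ) {u : R} (hu : IsUnit u) :
    ∃ (m : ℕ) (jJ : Fin m → {k : Fin n // k ≠ i}), Function.Injective jJ ∧ (∀ q, chartGen c i (jJ q).1 ∈ 𝔴) ∧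
      (∀ k : Fin n, k ≠ i → chartGen c i k ∈ 𝔴 → ∃ q, (jJ q).1 = k) ∧
      IsRsopPart (Fin.cons (χ (chartBase c i (c i)))
        (Fin.append (fun q => χ (chartGen c i (jJ q).1)) fun m' => χ (chartBase c i (w m'))) : Fin (m + l + 1) → L) ∧
      ∃ U : chartRing c i, U ∉ 𝔴 ∧ IsUnit (χ U) ∧ (U * ∏ q, chartGen c i (jJ q).1 ^ a (jJ q).1 = chartBase c i u * ∏ k, chartGen c i k ^ a k) ∧
      χ (chartBase c i (u * (∏ k, c k ^ a k) * ∏ m', w m' ^ b m')) =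
        χ U * χ (chartBase c i (c i)) ^ (∑ k, a k) * (∏ q, χ (chartGen c i (jJ q).1) ^ a (jJ q).1) * ∏ m', χ (chartBase c i (w m')) ^ b m' := by
  letI := χ.toAlgebra
  haveI := hloc
  haveI := isNoetherianRing_blowupChart c i
  obtain ⟨m, jJ, hjJ, hch, hcomplete, hrsop, U, hU𝔴, hunit, hUeq, heq⟩ :=
    exists_transform_normalForm_centreChart c i w hz hd (chartBase c i) (chartGen c i) (reesChartBase_apply_eq_mul_chartGen c i)
      (reesChartBase_mem_nonZeroDivisors _ _) (chartQuotEquiv c i (isQuasiRegular_centre c w hz hd)) (chartQuotMap_C c i)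
      (chartQuotMap_X c i) 𝔴 h𝔴 L a b hu
  exact ⟨m, jJ, hjJ, hch, hcomplete, hrsop, U, hU𝔴, hunit, hUeq, heq⟩

end ReesChart

/-! ## §3 Scheme level -/

set_option maxHeartbeats 800000 in
-- stalk-level bookkeeping of a long existential statement
/-- **NORMAL FORM OF THE TRANSFORM AT A POINT OF A BLOWING UP.**  Let `τ : X' → X` be a blowing up along `J` (`IsBlowup`), `x' ∈ X'`, `(c, w)` a
regular system of parameters of `𝒪_{X,τ x'}` (`n + l` generators of `𝔪`, `dim = n + l`) with `(c) = J_{τ x'}`, `u` a unit and `a, b` exponents.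
Then for some chart index `i` there are fractions `uf_k ∈ 𝒪_{X',x'}` with `τ^♯ c_k = τ^♯ cᵢ · uf_k`, `uf_i = 1`, an injective enumeration `jJ` of
exactly the charged indices (`k ≠ i`, `uf_k ∈ 𝔪_{x'}`) such that `(τ^♯ cᵢ, uf_{jJ}, τ^♯ w)` is part of a regular system of parameters of `𝒪_{X',x'}`,
and a unit `U` with `U · ∏_q uf_{jJ q}^{a_{jJ q}} = τ^♯ u · ∏_k uf_k^{a_k}` (i.e. `U = τ^♯ u · ∏_{uncharged} uf_k^{a_k}`) and
`τ^♯(u ∏ c_k^{a_k} ∏ w_m^{b_m}) = U · (τ^♯ cᵢ)^{Σ a_k} · ∏_q uf_{jJ q}^{a_{jJ q}} · ∏_m (τ^♯ w_m)^{b_m}`.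
[cite: DeJong1996, 2.4] [cite: StacksProject, Tag 0804] [cite: GortzWedhorn2020, Prop. 13.91] -/
theorem exists_transform_normalForm_of_isBlowup {X X' : Scheme.{u}} {τ : X' ⟶ X} {J : X.IdealSheafData} (hτ : IsBlowup τ J) (x' : X')
    (hR : IsRegularLocalRing (X.presheaf.stalk (τ x'))) {n l : ℕ} (c : Fin n → X.presheaf.stalk (τ x')) (w : Fin l → X.presheaf.stalk (τ x'))
    (hz : Ideal.span (Set.range (Fin.append c w)) = maximalIdeal (X.presheaf.stalk (τ x')))
    (hdim : ringKrullDim (X.presheaf.stalk (τ x')) = ((n + l : ℕ) : WithBot ℕ∞))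
    (hcJ : Ideal.span (Set.range c) = stalkIdeal J (τ x')) (a : Fin n → ℕ) (b : Fin l → ℕ)
    {u : X.presheaf.stalk (τ x')} (hu : IsUnit u) :
    ∃ (i : Fin n) (uf : Fin n → X'.presheaf.stalk x') (m : ℕ) (jJ : Fin m → {k : Fin n // k ≠ i}),
      (∀ k, (τ.stalkMap x').hom (c k) = (τ.stalkMap x').hom (c i) * uf k) ∧ uf i = 1 ∧
      Function.Injective jJ ∧ (∀ q, uf (jJ q).1 ∈ maximalIdeal (X'.presheaf.stalk x')) ∧
      (∀ k : Fin n, k ≠ i → uf k ∈ maximalIdeal (X'.presheaf.stalk x') → ∃ q, (jJ q).1 = k) ∧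
      IsRsopPart (Fin.cons ((τ.stalkMap x').hom (c i))
        (Fin.append (fun q => uf (jJ q).1) fun m' => (τ.stalkMap x').hom (w m')) : Fin (m + l + 1) → X'.presheaf.stalk x') ∧
      ∃ U : X'.presheaf.stalk x', IsUnit U ∧ (U * ∏ q, uf (jJ q).1 ^ a (jJ q).1 = (τ.stalkMap x').hom u * ∏ k, uf k ^ a k) ∧
      (τ.stalkMap x').hom (u * (∏ k, c k ^ a k) * ∏ m', w m' ^ b m') =
        U * (τ.stalkMap x').hom (c i) ^ (∑ k, a k) * (∏ q, uf (jJ q).1 ^ a (jJ q).1) * ∏ m', (τ.stalkMap x').hom (w m') ^ b m' := by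
  haveI := hR
  have hd : (maximalIdeal (X.presheaf.stalk (τ x'))).spanFinrank = n + l := by
    have h1 := IsRegularLocalRing.spanFinrank_maximalIdeal (R := X.presheaf.stalk (τ x'))
    rw [hdim] at h1
    exact_mod_cast h1
  obtain ⟨i, 𝔴, χ, hχ, hloc, hcomap⟩ := hτ.exists_reesChart_stalk x' c hcJ
  -- membership in `𝔴` is membership of the image in `𝔪_{x'}`
  have hmem : ∀ z : chartRing c i, χ z ∈ maximalIdeal (X'.presheaf.stalk x') ↔ z ∈ 𝔴.asIdeal := fun z => by
    letI := χ.toAlgebra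
    haveI := hloc
    exact IsLocalization.AtPrime.to_map_mem_maximal_iff (X'.presheaf.stalk x') 𝔴.asIdeal z
  obtain ⟨m, jJ, hjJ, hch, hcomplete, hrsop, U, -, hunit, hUeq, heq⟩ :=
    exists_transform_normalForm_reesChart c i w hz hd 𝔴.asIdeal hcomap (X'.presheaf.stalk x') χ hloc a b hu
  refine ⟨i, fun k => χ (chartGen c i k), m, jJ, fun k => ?_, ?_, hjJ, fun q => (hmem _).mpr (hch q),
    fun k hk hkm => hcomplete k hk ((hmem _).mp hkm), ?_, χ U, hunit, ?_, ?_⟩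
  · rw [← hχ, ← hχ, ← map_mul, reesChartBase_apply_eq_mul_chartGen c i k]
  · change χ (chartGen c i i) = 1
    rw [centreChartFrac_self c i (chartBase c i) (chartGen c i) (reesChartBase_apply_eq_mul_chartGen c i)
      (reesChartBase_mem_nonZeroDivisors _ _), map_one]
  · have h1 : (Fin.cons ((τ.stalkMap x').hom (c i)) (Fin.append (fun q => χ (chartGen c i (jJ q).1)) fun m' => (τ.stalkMap x').hom (w m')) :
        Fin (m + l + 1) → X'.presheaf.stalk x') =
        Fin.cons (χ (chartBase c i (c i))) (Fin.append (fun q => χ (chartGen c i (jJ q).1)) fun m' => χ (chartBase c i (w m'))) := by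
      rw [hχ]
      congr 1
      funext q
      refine Fin.addCases (fun q₁ => ?_) (fun q₂ => ?_) q
      · rw [Fin.append_left, Fin.append_left]
      · rw [Fin.append_right, Fin.append_right, hχ]
    rw [h1]
    exact hrsop
  · have hpow : ∀ (z : chartRing c i) (e : ℕ), χ (z ^ e) = χ z ^ e := fun z e => map_pow χ z e
    have h2 := congrArg χ hUeq
    rw [map_mul, map_mul, map_prod, map_prod, hχ] at h2
    simp only [hpow] at h2
    exact h2
  · rw [← hχ, heq, hχ]
    simp only [hχ]

end Summit.ResolutionOfSingularities.ResolutionOfSingularities.Theorems.RadicialJung.CleanModels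

end
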